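import Summits.QuantumFields.YangMills.Theorems.BalabanUVNodesN22WindowedNE9DichotomyLetter

/-!
# BalabanUVNodes ∕ node N22 = NE9 — THE (β′) LETTER `WindowedNE9 F (localizedSum F S emb) …` FROM OUTPUT-LEVEL DATA ONLY: coordinatewise coupling-Lipschitz
# letters of the (2.13) terms at complexified configurations ([I] p. 266 «𝐄^{(j)} … analytic functions of the effective coupling constants», quantified by Cauchy on
# uniform or relative margins) + holomorphy of the terms through the complexified readings + the minimizer tails — NO activity-level slot, NO (2.38), NO Road-1 numerals

Cell `pub-ymgap`, HUMAN RULING D-0062 (Track A), R134 seat `pub-ymgap-dag-n22-c` (strategy s1: «the history-Lipschitz estimate (2.40)–(2.41) p. 21 of [II] on the W1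
object»), generation 13, module J34.  THEOREMS ONLY (no `def`, no `def … : Prop`, no `sorry`); imports J33 part 2 `…Theorems.BalabanUVNodesN22WindowedNE9DichotomyLetter`
(p611709; through it J29's soft bound `abs_polWindow_localizedSum_sub_le_soft`, J31 ∕ J31b's generic Cauchy ∕ telescoping lemmas, dag-n22-w2's capstone engine
`windowedNE9_localizedSum_of_softSum`, J33's `dichotomySummand_le_softMajorant`) — consumed BY NAME.  Filed `--supports stmt-QuantumFields-20544` (K3⁷) as a HELPER.

WHY.  The kernel road of record (J27–J33, (A) p605956) reaches the (β′) letter through W1's ACTIVITY-level slots — because node N22's row is worded on the W1 object and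
(2.39)–(2.41) is an activity-to-term resummation.  But J29's law (N) is a statement about the (2.13) TERMS `E^{(k+1)}(X; hist; φ)` at complexified configurations, and
print's coupling-regularity clauses ARE term-level: [I] p. 263 «It is a C^∞-function of g_{j−1} ∈ [0, γ], (or analytic)», p. 266 «the functions 𝐄^{(j)}, β_j are analytic
functions of the effective coupling constants» (node00-def-W1's printed-type predicates `SmoothInLastOfRecord` ∕ `AnalyticInEachOfRecord`).  THIS FILE types the SHORTEST
road: per-coordinate OUTPUT-level coupling-Lipschitz letters at the configurations of the space tables ⟹ law (N) by telescoping (J31 §1 at `f := E^{(k+1)}(X; ·; φ)`) ⟹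
J29-soft ⟹ the letter by dag-n22-w2's engine; the letters come by Cauchy from coordinatewise OUTPUT-level holomorphy on uniform margins with (1.18) there (node N09's
`EHoloAt` shape, in EVERY coupling) or on relative margins (print's dilation shape, vertex-aware, in ANY coupling).  The activity level, Lemma 3's (2.38) and Road 1's
numerals do not appear: they are one SOURCE of these output-level facts (this lane's strip lineage `…N22W1StripOnDomain`, J30 v1.1, J33), not an input of the letter.

WHAT (0 `def`, 0 `sorry`).
* §1 `norm_clusterStepE_sub_le_of_outputCoordLetters` — law (N) at E-level from per-coordinate output letters `‖E(g) − E(g|g_i:=t)‖ ≤ Λ_i e^{−κd}|g_i − t|` on the box.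
* §2 `coordLetter_of_outputCoordHolo` (uniform `ρ`-discs about `]0,γ]` in coordinate `i`, bound `B e^{−κ_E d}`, `κ ≤ κ_E` ⟹ `Λ_i = 4B∕ρ`; J31 §2 BY NAME) ·
  `coordLetter_of_outputCoordHoloRel` (relative discs `D̄(s, c·s)`, bound `B′ s e^{−κ_E d}` ⟹ `Λ_i = 8B′∕min(c,1)`; J31b §1 BY NAME) · A5 rider `outputCoordLetters_termlessStep`.
* §3 `abs_polWindow_localizedSum_sub_le_soft_of_outputCoordLetters` — J29-soft with (N) from §1 at `φ := Φ_X z` and (C1) DISPLAYED at output level.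
* §4 ★★★ `windowedNE9_localizedSum_of_outputCoordLetters` (letters table `Λt`) and ★★★ `windowedNE9_localizedSum_of_outputCoordHolo` (uniform margins `ρt n i` in every
  coupling, bound `B e^{−κ_E d}`: moduli `C·4B∕ρt n i`, `C = (16B₃²∕r²)e^{12Mδ₁}K₀(64,8)K₁(4,δ₀∕2)`) — NO activity-level hypothesis, NO (2.38), NO Road-1 numerals.

HONEST FRAMING.  Count-neutral helper ∕ junction; the only estimates used are the two Cauchy lemmas and J28's bound inside J29, all in the tree.  DISPLAYED (hypotheses),
with owners: the OUTPUT-level coordinatewise coupling letters ∕ holomorphy data of the (2.13) terms at complexified configurations (older couplings: node N10's Lemmas 1–3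
«(or analytic)» transported to the terms — in the tree from activity-level data by S25 ∕ this lane's strip lineage — ∕ NODE A at the towers of record; last coupling: node
N09's `EHoloAt`; the relative edition is the cell's reading of print's dilation, NOT a printed estimate); OUTPUT-level holomorphy of the terms through the complexified
readings ([II] p. 15 + chain rule; from the activities by J30 v1.1 when wanted); the readings' chart ∕ space clauses and the tails ([I] p. 282) as in (A).  Nothing of
Bałaban's is constructed; N22 NOT discharged (typed 28∕28 · discharged 5∕27 UNCHANGED); K3⁷ OPEN; NE9 NOT IN PRINT for d = 4; one finite four-torus programme at fixed ε —
NOT infinite volume, NOT OS on ℝ⁴, NOT a mass gap, NOT Clay.  0 `sorry`, 0 `def`, standard axioms.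

References (TYPES only): [I] = [Balaban1987RG1] T. Bałaban, Commun. Math. Phys. **109** (1987) 249–301 — §1 p. 263, §2 p. 266, (1.7) p. 261, (1.18) p. 263,
(1.20)–(1.21) p. 264, p. 282, (5.10) p. 293; [II] = [Balaban1988RG2Cluster] Commun. Math. Phys. **116** (1988) 1–22 — (2.3) p. 12, (2.13) p. 14, p. 15.
-/

noncomputable section

open Filter Topology Set Metric
open scoped BigOperators

namespace YMDAG.N22.OutputLevel

open Literature.MathematicalPhysics.QuantumFieldTheory.Balaban1983to89
open Literature.MathematicalPhysics.QuantumFieldTheory.Balaban1983to89.T4Continuum (T4Family)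
open Literature.MathematicalPhysics.QuantumFieldTheory.Balaban1983to89.T4OutputRate (Window)
open Literature.MathematicalPhysics.QuantumFieldTheory.Balaban1983to89.TreeLengthTorus (TPt torusTreeLen torusTreeLen_nonneg)
open Literature.MathematicalPhysics.QuantumFieldTheory.Balaban1983to89.B12TreeDecay (K₀ kappa₀ K₀_pos)
open Literature.MathematicalPhysics.QuantumFieldTheory.Balaban1983to89.B12PolarizationTensor120 (expChart expChart_apply)
open Literature.MathematicalPhysics.QuantumFieldTheory.Balaban1983to89.B12Decay510 (delta1)
open Literature.MathematicalPhysics.QuantumFieldTheory.Balaban1983to89.B12Decay510Window (K₁)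
open Literature.MathematicalPhysics.QuantumFieldTheory.Balaban1983to89.B12Decay510Torus (distCT nearT)
open Literature.MathematicalPhysics.QuantumFieldTheory.Balaban1983to89.Node00
open Literature.MathematicalPhysics.QuantumFieldTheory.Balaban1983to89.Node00.Sect2 (domSys domCount CPair)
open Literature.MathematicalPhysics.QuantumFieldTheory.Balaban1983to89.Node00.W1
open Literature.MathematicalPhysics.QuantumFieldTheory.Balaban1983to89.Node00.LocalizedSum17 (localizedSum ReadingMaps)
open Literature.MathematicalPhysics.QuantumFieldTheory.Balaban1983to89.Node00.U3OfKernels (histPrefix histPrefix_apply)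
open Literature.MathematicalPhysics.QuantumFieldTheory.Balaban1983to89.Node00.U3KernelLetters (WindowedNE9)
open YMDAG.N22.W1 (norm_sub_le_sum_of_coordLipschitz norm_sub_update_le_of_coordHolo norm_sub_update_le_of_coordHoloRel)
open YMDAG.N22.WindowOfLocalTerms (abs_polWindow_localizedSum_sub_le_soft)
open YMDAG.N22.WindowSoftTwoPoint (windowedNE9_localizedSum_of_softSum sum_moduli_histPrefix_eq_sum_range)
open YMDAG.N22.WindowedOfCouplingHolo (histPrefix_mem_box)
open YMDAG.N22.Dichotomy (dichotomySummand_le_softMajorant)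

/-! ## §1 Law (N) at E-level from per-coordinate OUTPUT-level coupling letters -/

section Step
variable {P : Params} {𝔸 : Type*} {M k : ℕ}

/-- **LAW (N) FROM OUTPUT-LEVEL COORDINATE LETTERS.**  For W1's one-step data `S` at level `k`, space tables `sp`, the box `]0, γ]^{k+1}`: per-coordinate Lipschitz letters
of the (2.13) TERM, `‖E^{(k+1)}(X; g; φ) − E^{(k+1)}(X; g|g_i := t; φ)‖ ≤ Λ_i·e^{−κ d_{k+1}(X)}·|g_i − t|` for box prefixes `g`, `t ∈ ]0, γ]` and `φ ∈ sp X` ([I] p. 266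
«analytic functions of the effective coupling constants» quantified coordinatewise — DISPLAYED) give for two box prefixes and `φ ∈ sp X`:
`‖E^{(k+1)}(X; hist; φ) − E^{(k+1)}(X; hist′; φ)‖ ≤ e^{−κ d_{k+1}(X)}·Σ_i Λ_i|hist_i − hist′_i|` — J31's telescoping `norm_sub_le_sum_of_coordLipschitz` at
`f := E^{(k+1)}(X; ·; φ)` on the product box. [cite: Balaban1987RG1, §2 p.266 and §1 p.263] -/
theorem norm_clusterStepE_sub_le_of_outputCoordLetters (S : ClusterStep P 𝔸 M k) {γ : ℝ} (sp : (domSys P M (k + 1)).Dom → Set (CPair P 𝔸))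
    {κ : ℝ} (Λ : Fin (k + 1) → ℝ)
    (hlet : ∀ g ∈ box γ k, ∀ (i : Fin (k + 1)), ∀ t ∈ Ioc (0 : ℝ) γ, ∀ (X : (domSys P M (k + 1)).Dom), ∀ φ ∈ sp X,
      ‖S.E g φ X - S.E (Function.update g i t) φ X‖ ≤ Λ i * Real.exp (-(κ * (domSys P M (k + 1)).dj X)) * |g i - t|)
    {hist hist' : Fin (k + 1) → ℝ} (hh : hist ∈ box γ k) (hh' : hist' ∈ box γ k) (X : (domSys P M (k + 1)).Dom)
    {φ : CPair P 𝔸} (hφ : φ ∈ sp X) :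
    ‖S.E hist φ X - S.E hist' φ X‖ ≤ Real.exp (-(κ * (domSys P M (k + 1)).dj X)) * ∑ i, Λ i * |hist i - hist' i| := by
  have key := norm_sub_le_sum_of_coordLipschitz (fun g => S.E g φ X) (fun _ : Fin (k + 1) => Ioc (0 : ℝ) γ)
    (fun i => Real.exp (-(κ * (domSys P M (k + 1)).dj X)) * Λ i)
    (fun g hg i t ht => (hlet g hg i t ht X φ hφ).trans_eq (by ring)) hh hh'
  calc ‖S.E hist φ X - S.E hist' φ X‖ ≤ ∑ i, Real.exp (-(κ * (domSys P M (k + 1)).dj X)) * Λ i * |hist i - hist' i| := key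
    _ = Real.exp (-(κ * (domSys P M (k + 1)).dj X)) * ∑ i, Λ i * |hist i - hist' i| := by
        rw [Finset.mul_sum]
        exact Finset.sum_congr rfl fun i _ => by ring

/-! ## §2 The letters by Cauchy: uniform margins (N09's `EHoloAt` shape, any coupling) and relative margins (print's dilation shape, any coupling) -/

/-- **UNIFORM MARGIN IN COORDINATE `i` ⟹ THE LETTER.**  An OUTPUT-level holomorphy datum in the coupling `g_i` — per box prefix `g`, domain `X` and `φ ∈ sp X` a holomorphic
extension of `t ↦ E^{(k+1)}(X; g|g_i := t; φ)` to a set containing the closed `ρ`-discs about `]0, γ]`, bounded by `B·e^{−κ_E d_{k+1}(X)}` ([I] p. 266 «analytic» + (1.18) on the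
margin; for `i = k` node N09's `EHoloAt`) — gives the coordinate letter `Λ_i = 4B∕ρ` at every rate `κ ≤ κ_E` (`Dimock2015.real_param_lipschitz` through J31's
`norm_sub_update_le_of_coordHolo`). [cite: Balaban1987RG1, §2 p.266, §1 p.263 (clause before (1.18)) and (1.18)] -/
theorem coordLetter_of_outputCoordHolo (S : ClusterStep P 𝔸 M k) {γ : ℝ} (sp : (domSys P M (k + 1)).Dom → Set (CPair P 𝔸)) (i : Fin (k + 1))
    {B κ κE ρ : ℝ} (hB : 0 ≤ B) (hρ : 0 < ρ) (hκE : κ ≤ κE)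
    (hL : ∀ g ∈ box γ k, ∀ (X : (domSys P M (k + 1)).Dom), ∀ φ ∈ sp X,
      ∃ (Ec : ℂ → ℂ) (O : Set ℂ), DifferentiableOn ℂ Ec O ∧ (∀ t ∈ Ioc (0 : ℝ) γ, closedBall (t : ℂ) ρ ⊆ O) ∧
        (∀ z ∈ O, ‖Ec z‖ ≤ B * Real.exp (-(κE * (domSys P M (k + 1)).dj X))) ∧
        (∀ t ∈ Ioc (0 : ℝ) γ, Ec t = S.E (Function.update g i t) φ X)) :
    ∀ g ∈ box γ k, ∀ t ∈ Ioc (0 : ℝ) γ, ∀ (X : (domSys P M (k + 1)).Dom), ∀ φ ∈ sp X,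
      ‖S.E g φ X - S.E (Function.update g i t) φ X‖ ≤ 4 * B / ρ * Real.exp (-(κ * (domSys P M (k + 1)).dj X)) * |g i - t| := by
  intro g hg t ht X φ hφ
  obtain ⟨Ec, O, hhol, hdisc, hBd, hrep⟩ := hL g hg X φ hφ
  have hd : 0 ≤ (domSys P M (k + 1)).dj X := torusTreeLen_nonneg _
  have hexp : Real.exp (-(κE * (domSys P M (k + 1)).dj X)) ≤ Real.exp (-(κ * (domSys P M (k + 1)).dj X)) :=
    Real.exp_le_exp.2 (neg_le_neg (mul_le_mul_of_nonneg_right hκE hd))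
  have h4 : 0 ≤ 4 * B / ρ * |g i - t| := by positivity
  calc ‖S.E g φ X - S.E (Function.update g i t) φ X‖
      ≤ 4 * (B * Real.exp (-(κE * (domSys P M (k + 1)).dj X))) / ρ * |g i - t| :=
        norm_sub_update_le_of_coordHolo (fun g => S.E g φ X) Set.ordConnected_Ioc hρ g i (hg i) Ec O hhol hdisc hBd hrep ht
    _ = 4 * B / ρ * |g i - t| * Real.exp (-(κE * (domSys P M (k + 1)).dj X)) := by ring
    _ ≤ 4 * B / ρ * |g i - t| * Real.exp (-(κ * (domSys P M (k + 1)).dj X)) := mul_le_mul_of_nonneg_left hexp h4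
    _ = 4 * B / ρ * Real.exp (-(κ * (domSys P M (k + 1)).dj X)) * |g i - t| := by ring

/-- **RELATIVE MARGIN IN COORDINATE `i` ⟹ THE LETTER (vertex-aware edition).**  If the extension lives on the relative discs `D̄(s, c·s)`, `s ∈ ]0, γ]`, with a bound
`B′·s·e^{−κ_E d_{k+1}(X)}` vanishing linearly at the vertex (the cell's reading of `g_i` as the dilation parameter of its own step, (L5)∕[H-dil]; NOT a printed estimate), the
letter holds with `Λ_i = 8B′∕min(c,1)` (`T4CouplingAnalyticity.real_param_lipschitz_relW` through J31b's `norm_sub_update_le_of_coordHoloRel`).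
[cite: Balaban1987RG1, §2 p.266 and §1 p.263; Balaban1988RG2Cluster, (2.3) p.12] -/
theorem coordLetter_of_outputCoordHoloRel (S : ClusterStep P 𝔸 M k) {γ : ℝ} (sp : (domSys P M (k + 1)).Dom → Set (CPair P 𝔸)) (i : Fin (k + 1))
    {B' c κ κE : ℝ} (hB' : 0 ≤ B') (hc : 0 < c) (hκE : κ ≤ κE)
    (hL : ∀ g ∈ box γ k, ∀ (X : (domSys P M (k + 1)).Dom), ∀ φ ∈ sp X,
      ∃ (Ec : ℂ → ℂ) (O : Set ℂ), DifferentiableOn ℂ Ec O ∧ (∀ s ∈ Ioc (0 : ℝ) γ, closedBall (s : ℂ) (c * s) ⊆ O) ∧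
        (∀ s ∈ Ioc (0 : ℝ) γ, ∀ z ∈ closedBall (s : ℂ) (c * s), ‖Ec z‖ ≤ B' * s * Real.exp (-(κE * (domSys P M (k + 1)).dj X))) ∧
        (∀ s ∈ Ioc (0 : ℝ) γ, Ec s = S.E (Function.update g i s) φ X)) :
    ∀ g ∈ box γ k, ∀ t ∈ Ioc (0 : ℝ) γ, ∀ (X : (domSys P M (k + 1)).Dom), ∀ φ ∈ sp X,
      ‖S.E g φ X - S.E (Function.update g i t) φ X‖ ≤ 8 * B' / min c 1 * Real.exp (-(κ * (domSys P M (k + 1)).dj X)) * |g i - t| := by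
  intro g hg t ht X φ hφ
  obtain ⟨Ec, O, hhol, hdisc, hBd, hrep⟩ := hL g hg X φ hφ
  have hd : 0 ≤ (domSys P M (k + 1)).dj X := torusTreeLen_nonneg _
  have hexp : Real.exp (-(κE * (domSys P M (k + 1)).dj X)) ≤ Real.exp (-(κ * (domSys P M (k + 1)).dj X)) :=
    Real.exp_le_exp.2 (neg_le_neg (mul_le_mul_of_nonneg_right hκE hd))
  have hmin : 0 < min c 1 := lt_min hc one_pos
  have h8 : 0 ≤ 8 * B' / min c 1 * |g i - t| := by positivity
  calc ‖S.E g φ X - S.E (Function.update g i t) φ X‖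
      ≤ 8 * (B' * Real.exp (-(κE * (domSys P M (k + 1)).dj X))) / min c 1 * |g i - t| :=
        norm_sub_update_le_of_coordHoloRel (fun g => S.E g φ X) hc g i (hg i) Ec O hhol hdisc
          (fun s hs z hz => (hBd s hs z hz).trans_eq (by ring)) hrep ht
    _ = 8 * B' / min c 1 * |g i - t| * Real.exp (-(κE * (domSys P M (k + 1)).dj X)) := by ring
    _ ≤ 8 * B' / min c 1 * |g i - t| * Real.exp (-(κ * (domSys P M (k + 1)).dj X)) := mul_le_mul_of_nonneg_left hexp h8
    _ = 8 * B' / min c 1 * Real.exp (-(κ * (domSys P M (k + 1)).dj X)) * |g i - t| := by ring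

/-- **NON-VACUITY (A5 rider).**  The termless MODEL step carries every nonnegative letter table (its (2.13) terms do not read the couplings) — §1, §3, §4 are not vacuous
implications.  A model step, NOT NODE 00's. [folklore] -/
theorem outputCoordLetters_termlessStep {γ : ℝ} (sp : (domSys P M (k + 1)).Dom → Set (CPair P 𝔸)) {κ : ℝ} (Λ : Fin (k + 1) → ℝ) (hΛ : ∀ i, 0 ≤ Λ i) :
    ∀ g ∈ box γ k, ∀ (i : Fin (k + 1)), ∀ t ∈ Ioc (0 : ℝ) γ, ∀ (X : (domSys P M (k + 1)).Dom), ∀ φ ∈ sp X,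
      ‖(⟨PUnit, fun _ => ∅, fun _ _ _ => 0⟩ : ClusterStep P 𝔸 M k).E g φ X -
          (⟨PUnit, fun _ => ∅, fun _ _ _ => 0⟩ : ClusterStep P 𝔸 M k).E (Function.update g i t) φ X‖ ≤
        Λ i * Real.exp (-(κ * (domSys P M (k + 1)).dj X)) * |g i - t| := by
  intro g _ i t _ X φ _
  have e : ∀ g' : Fin (k + 1) → ℝ, (⟨PUnit, fun _ => ∅, fun _ _ _ => 0⟩ : ClusterStep P 𝔸 M k).E g' φ X =
      (⟨PUnit, fun _ => ∅, fun _ _ _ => 0⟩ : ClusterStep P 𝔸 M k).E g φ X := fun g' =>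
    ClusterStep.E_congr _ (fun Z _ => by simp [ClusterStep.H])
  rw [e (Function.update g i t), sub_self, norm_zero]
  have := hΛ i
  positivity

end Step

/-! ## §3 J29's soft windowed bound with (N) from §1 and (C1) displayed at OUTPUT level -/

section Window

variable {𝔄 : Type*} [NormedRing 𝔄] [NormedAlgebra ℝ 𝔄] {V : Type*} [NormedAddCommGroup V] [NormedSpace ℝ V] {ι' : Type*} [Fintype ι']
  {𝔸 : Type*} {M : ℕ} (F : T4Family) (S : (K : ℕ) → ClusterTower (F.P K) 𝔸 M) (emb : ReadingMaps F 𝔄 𝔸) (ρ : V →L[ℝ] 𝔄)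
  (bV : Module.Basis ι' ℝ V) (k K : ℕ) {Ec : Type*} [NormedAddCommGroup Ec] [NormedSpace ℂ Ec]

open Classical in
/-- **THE SOFT WINDOWED HISTORY-LIPSCHITZ BOUND OF THE (1.7) LOCALIZED SUM FROM OUTPUT-LEVEL DATA.**  J29's `abs_polWindow_localizedSum_sub_le_soft` for two box prefixes with (N)
supplied by §1 at the complexified configurations `Φ_X z ∈ sp X` and (C1) — holomorphy of `z ↦ E^{(k+1)}(X; hist; Φ_X z)` on the open `U_X ⊇ ball 0 r`, both histories —
DISPLAYED at output level ([II] p. 15 + chain rule; from the activities by J30 v1.1 when wanted).  No activity-level hypothesis, no (2.38), no Road-1 numerals.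
[cite: Balaban1987RG1, (1.7) p.261, §2 p.266, (1.20)-(1.21) p.264, (4.35)-(4.37) pp.290-291 and (5.10) p.293; Balaban1988RG2Cluster, (2.13) p.14 and p.15] -/
theorem abs_polWindow_localizedSum_sub_le_soft_of_outputCoordLetters
    {γ : ℝ} (sp : (domSys (F.P K) M (k + 1)).Dom → Set (CPair (F.P K) 𝔸)) {κ : ℝ} (Λ : Fin (k + 1) → ℝ)
    (hlet : ∀ g ∈ box γ k, ∀ (i : Fin (k + 1)), ∀ t ∈ Ioc (0 : ℝ) γ, ∀ (X : (domSys (F.P K) M (k + 1)).Dom), ∀ φ ∈ sp X,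
      ‖((S K) k).E g φ X - ((S K) k).E (Function.update g i t) φ X‖ ≤ Λ i * Real.exp (-(κ * (domSys (F.P K) M (k + 1)).dj X)) * |g i - t|)
    {hist hist' : Fin (k + 1) → ℝ} (hh : hist ∈ box γ k) (hh' : hist' ∈ box γ k)
    (ι : (domSys (F.P K) M (k + 1)).Dom → ((Fin (F.P K).d → Site (F.P K) (k + 1) → V) →L[ℝ] Ec))
    (Φ : (domSys (F.P K) M (k + 1)).Dom → Ec → CPair (F.P K) 𝔸)
    (U : (domSys (F.P K) M (k + 1)).Dom → Set Ec) (hU : ∀ X, IsOpen (U X)) {r : ℝ} (hr : 0 < r) (hrU : ∀ X, ball (0 : Ec) r ⊆ U X)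
    (hEhol : ∀ X, DifferentiableOn ℂ (fun z => ((S K) k).E hist (Φ X z) X) (U X))
    (hEhol' : ∀ X, DifferentiableOn ℂ (fun z => ((S K) k).E hist' (Φ X z) X) (U X))
    (hΦemb : ∀ X (B : Fin (F.P K).d → Site (F.P K) (k + 1) → V), Φ X (ι X B) = emb K k (fun l t => NormedSpace.exp (ρ (B l t))))
    (hΦsp : ∀ X, ∀ z ∈ ball (0 : Ec) r, Φ X z ∈ sp X)
    (w : (domSys (F.P K) M (k + 1)).Dom → Site (F.P K) (k + 1) → ℝ)
    (hw₀ : ∀ X t, 0 ≤ w X t) (hw : ∀ X (l : Fin (F.P K).d) (t : Site (F.P K) (k + 1)) (c : ι'), ‖ι X (Pi.single l (Pi.single t (bV c)))‖ ≤ w X t)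
    (μ ν : Fin 4) (z : Fin 4 → ℤ) :
    |polWindow F K (k + 1) (localizedSum F S emb k hist K) ρ bV μ ν z - polWindow F K (k + 1) (localizedSum F S emb k hist' K) ρ bV μ ν z| ≤
      ∑ X : (domSys (F.P K) M (k + 1)).Dom,
        16 * (Real.exp (-(κ * torusTreeLen X.1)) * ∑ i, Λ i * |hist i - hist' i|) / r ^ 2 *
          (w X (siteOfInt F K (k + 1) z) * w X (siteOfInt F K (k + 1) 0)) :=
  abs_polWindow_localizedSum_sub_le_soft F S emb ρ bV k K hist hist' ι
    (fun X z => ((S K) k).E hist (Φ X z) X) (fun X z => ((S K) k).E hist' (Φ X z) X) U hU hEhol hEhol' hr hrU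
    (fun X B => by rw [expChart_apply, hΦemb]) (fun X B => by rw [expChart_apply, hΦemb])
    (fun X => Real.exp (-(κ * torusTreeLen X.1)) * ∑ i, Λ i * |hist i - hist' i|)
    (fun X z hz => norm_clusterStepE_sub_le_of_outputCoordLetters ((S K) k) sp Λ hlet hh hh' X (hΦsp X z hz))
    w hw₀ hw μ ν z

end Window

/-! ## §4 ★★★ THE (β′) LETTER FROM OUTPUT-LEVEL DATA ONLY -/

section Letter

variable (F : T4Family) {𝔄 : Type*} [NormedRing 𝔄] [NormedAlgebra ℝ 𝔄] {V : Type*} [NormedAddCommGroup V] [NormedSpace ℝ V]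
  {ι' : Type*} [Fintype ι'] {𝔸 : Type*} {M : ℕ}

open Classical in
/-- ★★★ **THE (β′) LETTER FROM OUTPUT-LEVEL COORDINATE LETTERS.**  For node00-def-W1's term family `localizedSum F S emb` (W1-20), a window `W ⊆ Window γ`, cube side
`M = L^{m′}`: IF at every tower `S K` and level `k` the (2.13) terms carry per-coordinate OUTPUT-level coupling-Lipschitz letters
`‖E^{(k+1)}(X; g; φ) − E^{(k+1)}(X; g|g_i := t; φ)‖ ≤ Λt (k+1) i·e^{−κ d_{k+1}(X)}·|g_i − t|` on box prefixes and configurations `φ ∈ sp K k X` ([I] pp. 263∕266 quantified —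
older couplings N10 ∕ NODE A, last coupling N09; DISPLAYED, `Λt ≥ 0`); IF per `(K, k, X)` the complexified probe reading `Φ K k X` on an open `U K k X ⊇ ball 0 r` extends the reading
of the exponential chart, maps the ball into `sp K k X` and makes the TERM `z ↦ E^{(k+1)}(X; histPrefix g k; Φ K k X z)` holomorphic (`g ∈ W`; DISPLAYED at output level); IF the
complexifications' site weights carry the minimizer tails `w ≤ B₃e^{−δ₀ distCT(·, X)}` ([I] p. 282), `δ₀ > 0`, `2κ₀(64,8) ≤ κ`: THEN W1-19b's binder
`WindowedNE9 F (localizedSum F S emb) ρ bV W δ₁ (C·Λt)` holds, `C = (16B₃²∕r²)e^{12Mδ₁}K₀(64,8)K₁(4,δ₀∕2)`, `δ₁ = ½min{δ₀, κ(4M)⁻¹}` — §3 composed with dag-n22-w2's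
`windowedNE9_localizedSum_of_softSum` BY NAME.  NO activity-level hypothesis, NO (2.38), NO Road-1 numerals.
[cite: Balaban1987RG1, §1 p.263, §2 p.266, (1.7) p.261, (1.20)-(1.21) p.264 and (5.10) p.293; Balaban1988RG2Cluster, (2.13) p.14 and p.15] -/
theorem windowedNE9_localizedSum_of_outputCoordLetters (m' : ℕ) (M : ℕ) [NeZero M] (hM : M = F.L ^ m')
    (S : (K : ℕ) → ClusterTower (F.P K) 𝔸 M) (emb : ReadingMaps F 𝔄 𝔸) (ρ : V →L[ℝ] 𝔄) (bV : Module.Basis ι' ℝ V)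
    {γ : ℝ} (W : Set (ℕ → ℝ)) (hWγ : W ⊆ Window γ)
    (sp : (K k : ℕ) → (domSys (F.P K) M (k + 1)).Dom → Set (CPair (F.P K) 𝔸))
    {κ δ₀ B₃ r : ℝ} (Λt : ℕ → ℕ → ℝ) (hΛt : ∀ n i, 0 ≤ Λt n i)
    (hκ₀ : kappa₀ (4 * 2 ^ 4) (2 * 4) ≤ κ / 2) (hδ₀ : 0 < δ₀) (hB₃ : 0 ≤ B₃) (hr : 0 < r)
    (hlet : ∀ (K k : ℕ), ∀ g ∈ box γ k, ∀ (i : Fin (k + 1)), ∀ t ∈ Ioc (0 : ℝ) γ, ∀ (X : (domSys (F.P K) M (k + 1)).Dom), ∀ φ ∈ sp K k X,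
      ‖((S K) k).E g φ X - ((S K) k).E (Function.update g i t) φ X‖ ≤ Λt (k + 1) i * Real.exp (-(κ * (domSys (F.P K) M (k + 1)).dj X)) * |g i - t|)
    (Ec : ℕ → ℕ → Type*) [∀ K k, NormedAddCommGroup (Ec K k)] [∀ K k, NormedSpace ℂ (Ec K k)]
    (ι : (K k : ℕ) → (domSys (F.P K) M (k + 1)).Dom → ((Fin (F.P K).d → Site (F.P K) (k + 1) → V) →L[ℝ] Ec K k))
    (Φ : (K k : ℕ) → (domSys (F.P K) M (k + 1)).Dom → Ec K k → CPair (F.P K) 𝔸)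
    (U : (K k : ℕ) → (domSys (F.P K) M (k + 1)).Dom → Set (Ec K k)) (hU : ∀ K k X, IsOpen (U K k X)) (hrU : ∀ K k X, ball (0 : Ec K k) r ⊆ U K k X)
    (hEhol : ∀ g ∈ W, ∀ (K k : ℕ) (X : (domSys (F.P K) M (k + 1)).Dom),
      DifferentiableOn ℂ (fun z => ((S K) k).E (histPrefix g k) (Φ K k X z) X) (U K k X))
    (hΦemb : ∀ (K k : ℕ) (X : (domSys (F.P K) M (k + 1)).Dom) (B : Fin (F.P K).d → Site (F.P K) (k + 1) → V),
      Φ K k X (ι K k X B) = emb K k (fun l t => NormedSpace.exp (ρ (B l t))))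
    (hΦsp : ∀ (K k : ℕ) (X : (domSys (F.P K) M (k + 1)).Dom), ∀ z ∈ ball (0 : Ec K k) r, Φ K k X z ∈ sp K k X)
    (w : (K k : ℕ) → (domSys (F.P K) M (k + 1)).Dom → Site (F.P K) (k + 1) → ℝ) (hw₀ : ∀ K k X t, 0 ≤ w K k X t)
    (hw : ∀ (K k : ℕ) (X : (domSys (F.P K) M (k + 1)).Dom) (l : Fin (F.P K).d) (t : Site (F.P K) (k + 1)) (c : ι'),
      ‖ι K k X (Pi.single l (Pi.single t (bV c)))‖ ≤ w K k X t)
    (htail : ∀ (K k : ℕ) (X : (domSys (F.P K) M (k + 1)).Dom) (t : Site (F.P K) (k + 1)),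
      let e : Site (F.P K) (k + 1) → TPt 4 (domCount (F.P K) M (k + 1) * M) := fun x i => (ZMod.cast (x i) : ZMod (domCount (F.P K) M (k + 1) * M))
      w K k X t ≤ B₃ * Real.exp (-δ₀ * distCT (domCount (F.P K) M (k + 1)) M (e t) (nearT (M := M) (e t) X))) :
    WindowedNE9 F (localizedSum F S emb) ρ bV W (delta1 δ₀ κ ((M : ℝ) * 4))
      (fun n i => 16 * B₃ ^ 2 / r ^ 2 * Real.exp (delta1 δ₀ κ ((M : ℝ) * 4) * ((M : ℝ) * 4) * 3) * K₀ (4 * 2 ^ 4) (2 * 4) * K₁ 4 (δ₀ / 2) * Λt n i) := by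
  have hCE : (0 : ℝ) ≤ 16 * B₃ ^ 2 / r ^ 2 := by positivity
  refine windowedNE9_localizedSum_of_softSum F m' M hM S emb ρ bV W Λt hΛt hCE hδ₀ hκ₀
    (fun g g' k μ ν z K X => 16 * (Real.exp (-(κ * torusTreeLen X.1)) * ∑ i : Fin (k + 1), Λt (k + 1) i * |histPrefix g k i - histPrefix g' k i|) / r ^ 2 *
        (w K k X (siteOfInt F K (k + 1) z) * w K k X (siteOfInt F K (k + 1) 0)))
    (fun g hg g' hg' k μ ν z K => ?_) (fun g hg g' hg' k μ ν z K X => ?_)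
  · exact abs_polWindow_localizedSum_sub_le_soft_of_outputCoordLetters F S emb ρ bV k K (sp K k) (fun i : Fin (k + 1) => Λt (k + 1) i) (hlet K k)
      (histPrefix_mem_box (hWγ hg) k) (histPrefix_mem_box (hWγ hg') k) (ι K k) (Φ K k) (U K k) (hU K k) hr (hrU K k)
      (hEhol g hg K k) (hEhol g' hg' K k) (hΦemb K k) (hΦsp K k) (w K k) (hw₀ K k) (hw K k) μ ν z
  · exact dichotomySummand_le_softMajorant (Finset.sum_nonneg fun i _ => mul_nonneg (hΛt _ _) (abs_nonneg _))
      (sum_moduli_histPrefix_eq_sum_range Λt g g' k) hr hB₃ (hw₀ K k X _) (Real.exp_nonneg _) (htail K k X _) (htail K k X _)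

open Classical in
/-- ★★★ **THE (β′) LETTER FROM OUTPUT-LEVEL COUPLING HOLOMORPHY ON UNIFORM MARGINS IN EVERY COUPLING.**  As `windowedNE9_localizedSum_of_outputCoordLetters` with the letters
DISCHARGED by §2 from one datum per `(K, k, i)`: for every box prefix `g`, `X ∈ 𝐃_{k+1}` and `φ ∈ sp K k X` a holomorphic extension of `t ↦ E^{(k+1)}(X; g|g_i := t; φ)` to a set
containing the closed `ρt (k+1) i`-discs about `]0, γ]`, bounded by `B·e^{−κ_E d_{k+1}(X)}`, `κ ≤ κ_E` — [I] p. 266 «𝐄^{(j)} … analytic functions of the effective coupling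
constants» READ QUANTITATIVELY at complexified configurations (older couplings: N10 ∕ NODE A; last coupling: node N09's `EHoloAt`); moduli `C·4B∕ρt n i`.  Use the letters edition
with §2's relative lemma in any coupling whose margin is only relative (vertex-aware). [cite: Balaban1987RG1, §2 p.266, §1 p.263 (clause before (1.18)), (1.18), (1.20)-(1.21) p.264 and (5.10) p.293; Balaban1988RG2Cluster, (2.13) p.14 and p.15] -/
theorem windowedNE9_localizedSum_of_outputCoordHolo (m' : ℕ) (M : ℕ) [NeZero M] (hM : M = F.L ^ m')
    (S : (K : ℕ) → ClusterTower (F.P K) 𝔸 M) (emb : ReadingMaps F 𝔄 𝔸) (ρ : V →L[ℝ] 𝔄) (bV : Module.Basis ι' ℝ V)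
    {γ : ℝ} (W : Set (ℕ → ℝ)) (hWγ : W ⊆ Window γ)
    (sp : (K k : ℕ) → (domSys (F.P K) M (k + 1)).Dom → Set (CPair (F.P K) 𝔸))
    {κ κE δ₀ B₃ r B : ℝ} (ρt : ℕ → ℕ → ℝ) (hρt : ∀ n i, 0 < ρt n i)
    (hκ₀ : kappa₀ (4 * 2 ^ 4) (2 * 4) ≤ κ / 2) (hδ₀ : 0 < δ₀) (hB₃ : 0 ≤ B₃) (hr : 0 < r) (hB : 0 ≤ B) (hκE : κ ≤ κE)
    (hL : ∀ (K k : ℕ) (i : Fin (k + 1)), ∀ g ∈ box γ k, ∀ (X : (domSys (F.P K) M (k + 1)).Dom), ∀ φ ∈ sp K k X,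
      ∃ (Ec : ℂ → ℂ) (O : Set ℂ), DifferentiableOn ℂ Ec O ∧ (∀ t ∈ Ioc (0 : ℝ) γ, closedBall (t : ℂ) (ρt (k + 1) i) ⊆ O) ∧
        (∀ z ∈ O, ‖Ec z‖ ≤ B * Real.exp (-(κE * (domSys (F.P K) M (k + 1)).dj X))) ∧
        (∀ t ∈ Ioc (0 : ℝ) γ, Ec t = ((S K) k).E (Function.update g i t) φ X))
    (Ec : ℕ → ℕ → Type*) [∀ K k, NormedAddCommGroup (Ec K k)] [∀ K k, NormedSpace ℂ (Ec K k)]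
    (ι : (K k : ℕ) → (domSys (F.P K) M (k + 1)).Dom → ((Fin (F.P K).d → Site (F.P K) (k + 1) → V) →L[ℝ] Ec K k))
    (Φ : (K k : ℕ) → (domSys (F.P K) M (k + 1)).Dom → Ec K k → CPair (F.P K) 𝔸)
    (U : (K k : ℕ) → (domSys (F.P K) M (k + 1)).Dom → Set (Ec K k)) (hU : ∀ K k X, IsOpen (U K k X)) (hrU : ∀ K k X, ball (0 : Ec K k) r ⊆ U K k X)
    (hEhol : ∀ g ∈ W, ∀ (K k : ℕ) (X : (domSys (F.P K) M (k + 1)).Dom),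
      DifferentiableOn ℂ (fun z => ((S K) k).E (histPrefix g k) (Φ K k X z) X) (U K k X))
    (hΦemb : ∀ (K k : ℕ) (X : (domSys (F.P K) M (k + 1)).Dom) (B : Fin (F.P K).d → Site (F.P K) (k + 1) → V),
      Φ K k X (ι K k X B) = emb K k (fun l t => NormedSpace.exp (ρ (B l t))))
    (hΦsp : ∀ (K k : ℕ) (X : (domSys (F.P K) M (k + 1)).Dom), ∀ z ∈ ball (0 : Ec K k) r, Φ K k X z ∈ sp K k X)
    (w : (K k : ℕ) → (domSys (F.P K) M (k + 1)).Dom → Site (F.P K) (k + 1) → ℝ) (hw₀ : ∀ K k X t, 0 ≤ w K k X t)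
    (hw : ∀ (K k : ℕ) (X : (domSys (F.P K) M (k + 1)).Dom) (l : Fin (F.P K).d) (t : Site (F.P K) (k + 1)) (c : ι'),
      ‖ι K k X (Pi.single l (Pi.single t (bV c)))‖ ≤ w K k X t)
    (htail : ∀ (K k : ℕ) (X : (domSys (F.P K) M (k + 1)).Dom) (t : Site (F.P K) (k + 1)),
      let e : Site (F.P K) (k + 1) → TPt 4 (domCount (F.P K) M (k + 1) * M) := fun x i => (ZMod.cast (x i) : ZMod (domCount (F.P K) M (k + 1) * M))
      w K k X t ≤ B₃ * Real.exp (-δ₀ * distCT (domCount (F.P K) M (k + 1)) M (e t) (nearT (M := M) (e t) X))) :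
    WindowedNE9 F (localizedSum F S emb) ρ bV W (delta1 δ₀ κ ((M : ℝ) * 4))
      (fun n i => 16 * B₃ ^ 2 / r ^ 2 * Real.exp (delta1 δ₀ κ ((M : ℝ) * 4) * ((M : ℝ) * 4) * 3) * K₀ (4 * 2 ^ 4) (2 * 4) * K₁ 4 (δ₀ / 2) *
        (4 * B / ρt n i)) :=
  windowedNE9_localizedSum_of_outputCoordLetters F m' M hM S emb ρ bV W hWγ sp (fun n i => 4 * B / ρt n i)
    (fun n i => div_nonneg (mul_nonneg (by norm_num) hB) (hρt n i).le) hκ₀ hδ₀ hB₃ hr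
    (fun K k g hg i => coordLetter_of_outputCoordHolo ((S K) k) (sp K k) i hB (hρt _ _) hκE (hL K k i) g hg)
    Ec ι Φ U hU hrU hEhol hΦemb hΦsp w hw₀ hw htail

end Letter

end YMDAG.N22.OutputLevel

end
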